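import Mathlib
import Literature.MathematicalPhysics.QuantumFieldTheory.Balaban1983to89.B10Eq70Squaring
import Literature.MathematicalPhysics.QuantumFieldTheory.BalabanImbrieJaffe1984to88.BIJ85Ineq722Torus
import Summits.QuantumFields.Balaban3D.Carriers.Regions

/-!
# `Summit.QuantumFields.Balaban3D.Proofs.TorusLift` — lane «pub-balaban3d» (Bałaban, CMP **102** (1985) 255–275, d = 3 lattice UV
# stability AS PRINTED), prover seat p2: the dictionary between the 4D cell's `ηℤ^d` geometry of (69)–(71) (`B7Prop1Explicit.Site`,
# `B10Eq70Squaring.deltaBox`) and the lane's torus carriers (`Setup.Site P 0`, seat p1's `Carriers.Regions.coarsen`/`plaqCover`)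

HONEST FRAMING (lane PLAN.md §0).  Nothing of [B10] = [Balaban1985UV3] is asserted; lattice bookkeeping only.
* `projSite` — the projection `ℤ^d → T_η` (integer coordinates ↦ `ZMod` labels at scale `0`); `projSite_add_e` (compatible with the
  unit shifts), `val_projSite` (no reduction inside the fundamental domain), `projSite_injOn_deltaBox` (injective on every region
  `Δ′` of (70) of side `2L^j ≤` the period);
* `val_coarsen` — the scale-`j` block of a fine site has labels `⌊label / L^j⌋` (p1's `coarsen` = `blockOf` iterated);
* `projSite_mem_plaqCover` — a site of the region `Δ′ = B^j(x₀) ∪ B^j(y₀) ∪ B^j(z₀) ∪ B^j(w₀)` of (70) built on the integer labels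
  of a scale-`j` torus plaquette `p′` projects to a fine site COVERED by `p′` (p1's `plaqCover`: its scale-`j` block is a corner of `p′`)
  — the link between the per-plaquette small factor (71) on `ηℤ^d` (`…Proofs.PerPlaquette71.perPlaquette71_local`) and the lane's
  regions `Λ_j(h) ⊇ plaqCover p′` (multiplicity of the cover, admissible histories).
-/

namespace Summit.QuantumFields.Balaban3D.Proofs.TorusLift

open Literature.MathematicalPhysics.QuantumFieldTheory.Balaban1983to89
open Summit.QuantumFields.Balaban3D.Carriers
open B10Eq70Squaring (deltaBox mem_deltaBox side)

variable {P : Params}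

/-! ## §1 Labels of blocks; the period as a multiple of the block size -/

/-- The labels of the scale-`j` block of a fine site are the integer quotients `label / L^j`. [folklore] -/
theorem val_coarsen : ∀ (j : ℕ), j ≤ P.m + P.K → ∀ (x : Site P 0) (κ : Fin P.d),
    ((coarsen j x) κ).val = (x κ).val / P.L ^ j
  | 0, _, x, κ => by simp [coarsen]
  | j + 1, hj, x, κ => by
    show ((blockOf (coarsen j x)) κ).val = _
    rw [Site.val_blockOf (by omega) (coarsen j x) κ, val_coarsen j (by omega) x κ, Nat.div_div_eq_div_mul, pow_succ]

/-! ## §2 The projection `ℤ^d → T_η` -/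

/-- The projection of integer coordinates to the torus `T_η = T^{(0)}` (labels mod the period). [folklore] -/
def projSite (y : B7Prop1Explicit.Site P.d) : Site P 0 := fun κ => ((y κ : ℤ) : ZMod (P.sitesPerDir 0))

/-- `projSite_apply`. [folklore] -/
theorem projSite_apply (y : B7Prop1Explicit.Site P.d) (κ : Fin P.d) :
    projSite y κ = ((y κ : ℤ) : ZMod (P.sitesPerDir 0)) := rfl

/-- The projection intertwines the unit steps: `proj (y + e_μ) = (proj y) + e_μ`. [folklore] -/
theorem projSite_add_e (y : B7Prop1Explicit.Site P.d) (μ : Fin P.d) :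
    projSite (y + B7Prop1Explicit.e μ) = (projSite y).shift μ := by
  funext κ
  simp only [projSite, Pi.add_apply, B7Prop1Explicit.e_apply, Site.shift, Function.update_apply]
  by_cases h : κ = μ
  · subst h; simp
  · simp [h]

/-- Inside the fundamental domain no reduction occurs. [folklore] -/
theorem val_projSite {y : B7Prop1Explicit.Site P.d} {κ : Fin P.d} (h0 : 0 ≤ y κ) (hM : y κ < P.sitesPerDir 0) :
    (((projSite y) κ).val : ℤ) = y κ := by
  rw [projSite_apply, ZMod.val_intCast, Int.emod_eq_of_lt h0 hM]

/-- The projection is injective on every region `Δ′` of (70) whose sides `≤ 2n` do not exceed the period. [folklore] -/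
theorem projSite_injOn_deltaBox {n : ℕ} (hn : 2 * n ≤ P.sitesPerDir 0) (x₀ : B7Prop1Explicit.Site P.d) (μ ν : Fin P.d) :
    Set.InjOn (projSite (P := P)) (deltaBox n x₀ μ ν : Set (B7Prop1Explicit.Site P.d)) := by
  intro y hy y' hy' h
  funext κ
  have h1 := (mem_deltaBox n x₀ μ ν).mp (Finset.mem_coe.mp hy) κ
  have h2 := (mem_deltaBox n x₀ μ ν).mp (Finset.mem_coe.mp hy') κ
  have hs : (side n μ ν κ : ℤ) ≤ 2 * n := by
    unfold side; split_ifs <;> push_cast <;> omega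
  have hκ := congrFun h κ
  rw [projSite_apply, projSite_apply, ZMod.intCast_eq_intCast_iff_dvd_sub] at hκ
  simp only [Pi.sub_apply] at h1 h2
  have habs : |y' κ - y κ| < (P.sitesPerDir 0 : ℤ) := by
    rw [abs_lt]; constructor <;> omega
  have := Int.eq_zero_of_abs_lt_dvd hκ habs
  omega

/-! ## §3 Sites of `Δ′(p′)` project into the cover of `p′` -/

/-- The integer position of a scale-`j` torus plaquette's base point (its labels as integers). [folklore] -/
def zOf {j : ℕ} (p : Plaq P j) : B7Prop1Explicit.Site P.d := fun κ => (((p.src κ).val : ℕ) : ℤ)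

/-- `zOf_apply`. [folklore] -/
theorem zOf_apply {j : ℕ} (p : Plaq P j) (κ : Fin P.d) : zOf p κ = (((p.src κ).val : ℕ) : ℤ) := rfl

/-- One coordinate of the key computation, in `ℕ`: for `Y = n·lab + T` with `T < 2n`, `lab < M′`, the scale-`j` label of the
reduction of `Y` modulo the period `M′·n`, namely `(Y mod M′n) / n`, is `lab + T / n` modulo `M′`. [folklore] -/
theorem coarse_label_nat {n M' lab T : ℕ} (hn : 0 < n) (hlab : lab < M') (hT : T < 2 * n) :
    ((n * lab + T) % (M' * n)) / n % M' = (lab + T / n) % M' := by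
  have hdm := Nat.div_add_mod T n
  have hr : T % n < n := Nat.mod_lt _ hn
  have ha : T / n ≤ 1 := by
    have : T / n < 2 := (Nat.div_lt_iff_lt_mul hn).mpr (by linarith)
    omega
  have hY : n * lab + T = n * (lab + T / n) + T % n := by
    rw [Nat.mul_add]; omega
  rw [hY]
  rcases Nat.lt_or_ge (lab + T / n) M' with hlt | hge
  · -- no wrap-around
    have hlt' : n * (lab + T / n) + T % n < M' * n := by
      have h1 : n * (lab + T / n) + T % n < n * (lab + T / n) + n := by omega
      have h2 : n * (lab + T / n) + n = n * (lab + T / n + 1) := by ring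
      have h3 : n * (lab + T / n + 1) ≤ n * M' := Nat.mul_le_mul_left _ (by omega)
      rw [Nat.mul_comm M' n]; omega
    rw [Nat.mod_eq_of_lt hlt', Nat.mul_add_div hn, Nat.div_eq_of_lt hr, Nat.add_zero]
  · -- wrap-around: lab + T / n = M′ exactly
    have heq : lab + T / n = M' := by omega
    have hM'0 : 0 < M' := by omega
    rw [heq, Nat.mul_comm n M', Nat.add_mod_left, Nat.mod_eq_of_lt (lt_of_lt_of_le hr (Nat.le_mul_of_pos_left n hM'0)),
      Nat.div_eq_of_lt hr, Nat.mod_self, Nat.zero_mod]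

/-- `Site.shift` by coordinates. [folklore] -/
theorem shift_apply {j : ℕ} (x : Site P j) (μ κ : Fin P.d) : (x.shift μ) κ = if κ = μ then x μ + 1 else x κ := by
  unfold Site.shift
  by_cases h : κ = μ
  · subst h; simp
  · simp [h]

/-- **A site of `Δ′(p′)` projects into the cover of `p′`:** for a scale-`j` torus plaquette `p′` (`j ≤ m + K`) and an integer site
`y` of the region `deltaBox (L^j) (L^j • zOf p′) p′.μ p′.ν` of (70) built on its labels, the scale-`j` block of `projSite y` is one
of the four corners of `p′`, i.e. `projSite y ∈ plaqCover p′`. [cite: Balaban1985UV3, (69)–(70) p.273] -/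
theorem projSite_mem_plaqCover {j : ℕ} (hj : j ≤ P.m + P.K) (p : Plaq P j) {y : B7Prop1Explicit.Site P.d}
    (hy : y ∈ deltaBox (P.L ^ j) ((P.L ^ j : ℕ) • zOf p) p.μ p.ν) : projSite y ∈ plaqCover p := by
  classical
  have hn : 0 < P.L ^ j := pow_pos P.L_pos j
  have hM : P.sitesPerDir 0 = P.sitesPerDir j * P.L ^ j :=
    Literature.MathematicalPhysics.QuantumFieldTheory.BalabanImbrieJaffe1984to88.BIJ85Ineq722Torus.sitesPerDir_zero_eq hj
  have hμν : p.μ ≠ p.ν := ne_of_lt p.hμν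
  have hbox := (mem_deltaBox (P.L ^ j) ((P.L ^ j : ℕ) • zOf p) p.μ p.ν).mp hy
  -- per coordinate: the scale-j label of the projection is `lab + a`, `a ∈ {0,1}`, `a = 0` off the plaquette's directions
  have hcoord : ∀ κ, ∃ a : ℕ, a ≤ 1 ∧ (κ ≠ p.μ → κ ≠ p.ν → a = 0) ∧
      (coarsen j (projSite y)) κ = p.src κ + (a : ZMod (P.sitesPerDir j)) := by
    intro κ
    obtain ⟨h0, h1⟩ := hbox κ
    simp only [Pi.sub_apply, nsmul_eq_mul] at h0 h1
    set lab : ℕ := (p.src κ).val with hlab_def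
    have hlab : lab < P.sitesPerDir j := ZMod.val_lt _
    set T : ℕ := (y κ - (P.L ^ j : ℕ) * (lab : ℤ)).toNat with hT_def
    have hTz : (T : ℤ) = y κ - (P.L ^ j : ℕ) * (lab : ℤ) := Int.toNat_of_nonneg h0
    have hTs : T < side (P.L ^ j) p.μ p.ν κ := by
      have : (T : ℤ) < side (P.L ^ j) p.μ p.ν κ := by rw [hTz]; exact h1
      exact_mod_cast this
    have hyκ : y κ = ((P.L ^ j * lab + T : ℕ) : ℤ) := by push_cast at hTz ⊢; linarith
    have hside1 : side (P.L ^ j) p.μ p.ν κ ≤ 2 * P.L ^ j := by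
      unfold side; split_ifs <;> omega
    have hside2 : κ ≠ p.μ → κ ≠ p.ν → side (P.L ^ j) p.μ p.ν κ = P.L ^ j := by
      intro h1 h2; unfold side; rw [if_neg (not_or.mpr ⟨h1, h2⟩)]
    refine ⟨T / P.L ^ j, ?_, ?_, ?_⟩
    · have : T / P.L ^ j < 2 := (Nat.div_lt_iff_lt_mul hn).mpr (by linarith)
      omega
    · intro h1 h2
      rw [Nat.div_eq_of_lt]
      rw [← hside2 h1 h2]; exact hTs
    · have hval : ((coarsen j (projSite y)) κ).val =
          ((P.L ^ j * lab + T) % (P.sitesPerDir j * P.L ^ j)) / P.L ^ j := by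
        rw [val_coarsen j hj, projSite_apply, hyκ, Int.cast_natCast, ZMod.val_natCast, hM]
      rw [← ZMod.natCast_zmod_val ((coarsen j (projSite y)) κ), hval, ← ZMod.natCast_zmod_val (p.src κ), ← hlab_def,
        ← Nat.cast_add, ZMod.natCast_eq_natCast_iff']
      exact coarse_label_nat hn hlab (lt_of_lt_of_le hTs hside1)
  obtain ⟨aμ, haμ1, -, hCμ⟩ := hcoord p.μ
  obtain ⟨aν, haν1, -, hCν⟩ := hcoord p.ν
  have hC : ∀ κ, (coarsen j (projSite y)) κ =
      if κ = p.μ then p.src p.μ + (aμ : ZMod (P.sitesPerDir j))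
      else if κ = p.ν then p.src p.ν + (aν : ZMod (P.sitesPerDir j)) else p.src κ := by
    intro κ
    by_cases h1 : κ = p.μ
    · subst h1; rw [if_pos rfl]; exact hCμ
    · rw [if_neg h1]
      by_cases h2 : κ = p.ν
      · subst h2; rw [if_pos rfl]; exact hCν
      · rw [if_neg h2]
        obtain ⟨a, -, ha0, hCa⟩ := hcoord κ
        rw [hCa, ha0 h1 h2, Nat.cast_zero, add_zero]
  unfold plaqCover
  simp only [Set.mem_setOf_eq]
  have hμ01 : aμ = 0 ∨ aμ = 1 := by omega
  have hν01 : aν = 0 ∨ aν = 1 := by omega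
  rcases hμ01 with rfl | rfl <;> rcases hν01 with rfl | rfl
  · refine Or.inl ?_
    funext κ
    rw [hC]
    rcases eq_or_ne κ p.μ with h1 | h1
    · subst h1; simp
    · rcases eq_or_ne κ p.ν with h2 | h2
      · subst h2; simp [h1]
      · simp [h1, h2]
  · refine Or.inr (Or.inr (Or.inl ?_))
    funext κ
    rw [hC]
    simp only [shift_apply]
    rcases eq_or_ne κ p.μ with h1 | h1
    · subst h1; simp [hμν]
    · rcases eq_or_ne κ p.ν with h2 | h2
      · subst h2; simp [h1]
      · simp [h1, h2]
  · refine Or.inr (Or.inl ?_)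
    funext κ
    rw [hC]
    simp only [shift_apply]
    rcases eq_or_ne κ p.μ with h1 | h1
    · subst h1; simp
    · rcases eq_or_ne κ p.ν with h2 | h2
      · subst h2; simp [h1]
      · simp [h1, h2]
  · refine Or.inr (Or.inr (Or.inr ?_))
    funext κ
    rw [hC]
    simp only [shift_apply]
    rcases eq_or_ne κ p.μ with h1 | h1
    · subst h1; simp [hμν]
    · rcases eq_or_ne κ p.ν with h2 | h2
      · subst h2; simp [h1]
      · simp [h1, h2]

end Summit.QuantumFields.Balaban3D.Proofs.TorusLift
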